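import Literature.NumberTheory.GaloisCohomology.Howard2004.SelmerAScalarStabilityProofs
import HarnessLib

/-!
# Representatives of `H¹_F(K, A) = colim_k H¹_{F}(K, T/𝔪^{e_k}T)`: the defining family is DIRECTED, so a class of
# `H¹(K, A)` lies in `H¹_F(K, A)` iff ONE of its lifts is a Selmer class (Howard 2004 §1.6) — proofs file

Topic `NumberTheory/GaloisCohomology/Howard2004` (sequel to `SelmerAScalarStabilityProofs`, p664545, and `DVRKolyvaginBound`:
`AdicTower.incLoc/incLocIter/incH1/incH1LE/condA/H1A/selmerA`). THEOREMS ONLY: no definition, no named fact, no instance,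
no `sorry`.

WHY (cell `pub/bsd-print-x9`, shared μ-crux `MuInequalityCoherentPairOfPrint{,CG}`, STUB B, the index clause `Stmt.readoutIndex`
(B5), seat `bsd-line-x10b-p1-w2` g10, brick (B5-rep)). `selmerA F = ⨆_j of_j(H¹_{condA F j}(K, T_j))` is a supremum of
subgroups; to bound `H¹(K, A)_{Sel} ⧸ H¹_F(K, A)` place by place one needs that membership of a class `[c]` (`c` at level `j`)
in `H¹_F(K, A)` is witnessed at ONE level: `[c] ∈ H¹_F(K, A) ↔ ∃ l ≥ j, inc_{j→l} c ∈ H¹_{condA F l}(K, T_l)`. This holds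
because the transition maps carry Selmer classes to Selmer classes — `H¹(K_v, inc)` maps the propagated condition
`condA F j v` into `condA F (j+1) v` (from `cond_red` + `cond_smul`: `inc ∘ red = π^{e_{k+1}-e_k}`, p664545 §4) — so the
family is directed and the supremum is a directed union.

* `AdicTower.directedSystem_incH1LE` — `(H¹(K, T_k), incH1LE)` is a `DirectedSystem` (so Mathlib's `DirectLimit.of.zero_exact`
  applies); `incH1LE_succ_self`;
* `AdicTower.incLocIter_succ_heq`, `heq_incLoc`, `mem_iff_of_heq` — the index bookkeeping `incLocIter (j+1) d ∘ incLoc j ≍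
  incLocIter j (d+1)` (heterogeneous, the indices `j+1+d` and `j+(d+1)` being only propositionally equal);
* `AdicTower.mem_condA_iff`, **`incLoc_mem_condA`** — `condA F j v` is the directed union `⋃_d incLocIter⁻¹(F_{j+d,v})` and is
  carried into `condA F (j+1) v` by `H¹(K_v, inc_j)`;
* **`AdicTower.incH1_mem_selmerGroup_condA`**, `incH1LE_mem_selmerGroup_condA`, `monotone_map_of_selmerGroup_condA`;
* **`AdicTower.mem_selmerA_iff`**, **`AdicTower.of_mem_selmerA_iff`** — the single-representative criteria;
* `DVRSetting.of_mem_selmerA_iff` — the same for a `DVRSetting` with H.0–H.5.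

References: [Howard2004HeegnerKolyvagin] B. Howard, Compositio Math. 140 (2004), Def. 1.1.1, Def. 1.1.3, §1.6 / Thm. 1.6.1
(arXiv:1202.6340 p. 5 L20–45, p. 11 L18–28, p. 12 L40–48); [SerreGaloisCohomology1997] I §2.2–2.4.  BSD is not proved by any of this.
-/

set_option autoImplicit false

noncomputable section

open Function NumberField IsDedekindDomain Field
open scoped NumberField ContRepresentation

namespace Literature.NumberTheory.GaloisCohomology.Howard2004

open Literature.NumberTheory.GaloisRepresentations
open Literature.NumberTheory.GaloisRepresentations.DiscreteGaloisModule
open Literature.NumberTheory.GaloisRepresentations.galoisCohomology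

namespace AdicTower

variable {K : Type} [Field K] [NumberField K] {R : Type} [CommRing R] [IsLocalRing R]
  {N : ℕ → Type} [∀ k, AddCommGroup (N k)] [∀ k, TopologicalSpace (N k)] [∀ k, DiscreteTopology (N k)]
  [∀ k, Module R (N k)]
  (T : AdicTower K R N) (π : R) (e : ℕ → ℕ)
  (hkill : ∀ k, ∀ r ∈ IsLocalRing.maximalIdeal R ^ e k, ∀ x : N k, r • x = 0)
  (hker : ∀ k, LinearMap.ker (T.red k) = (IsLocalRing.maximalIdeal R ^ e k) • (⊤ : Submodule R (N (k + 1))))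
  (hπ : π ∈ IsLocalRing.maximalIdeal R) (he : ∀ k, e k ≤ e (k + 1))

/-! ## §1 `(H¹(K, T_k), incH1LE)` is a directed system -/

omit [NumberField K] in
/-- `incH1LE i (i+1) = incH1 i`. [cite: Howard2004HeegnerKolyvagin, §1.6 (arXiv p. 12, L40–48)] -/
theorem incH1LE_succ_self (i : ℕ) (h : i ≤ i + 1) (c : galoisCohomology (T.ρ i) 1) :
    incH1LE T π e hkill hker hπ he i (i + 1) h c = incH1 T π e hkill hker hπ he i c := by
  have h1 : incH1LE T π e hkill hker hπ he i (i + 1) (Nat.le_succ_of_le (le_refl i)) =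
      (incH1 T π e hkill hker hπ he i).comp (incH1LE T π e hkill hker hπ he i i (le_refl i)) :=
    Nat.leRec_succ _ _ (le_refl i)
  have h0 : incH1LE T π e hkill hker hπ he i i (le_refl i) = AddMonoidHom.id _ := Nat.leRec_self _ _
  rw [h1, h0]
  rfl

omit [NumberField K] in
/-- `incH1LE j k ∘ incH1LE i j = incH1LE i k`. [cite: Howard2004HeegnerKolyvagin, §1.6 (arXiv p. 12, L40–48)] -/
theorem incH1LE_incH1LE (i j : ℕ) (hij : i ≤ j) :
    ∀ (k : ℕ) (hjk : j ≤ k) (c : galoisCohomology (T.ρ i) 1),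
      incH1LE T π e hkill hker hπ he j k hjk (incH1LE T π e hkill hker hπ he i j hij c) =
        incH1LE T π e hkill hker hπ he i k (hij.trans hjk) c := by
  intro k hjk
  induction hjk with
  | refl =>
    intro c
    have h0 : incH1LE T π e hkill hker hπ he j j le_rfl = AddMonoidHom.id _ := Nat.leRec_self _ _
    rw [h0]
    rfl
  | @step k hle ih =>
    intro c
    have h1 : incH1LE T π e hkill hker hπ he j (k + 1) (Nat.le.step hle) =
        (incH1 T π e hkill hker hπ he k).comp (incH1LE T π e hkill hker hπ he j k hle) :=
      Nat.leRec_succ _ _ hle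
    have h2 : incH1LE T π e hkill hker hπ he i (k + 1) (hij.trans (Nat.le.step hle)) =
        (incH1 T π e hkill hker hπ he k).comp (incH1LE T π e hkill hker hπ he i k (hij.trans hle)) :=
      Nat.leRec_succ _ _ (hij.trans hle)
    rw [h1, h2, AddMonoidHom.comp_apply, AddMonoidHom.comp_apply, ih]

omit [NumberField K] in
/-- **`(H¹(K, T/𝔪^{e_k}T))_k` with the maps `incH1LE` is a directed system** (Mathlib `DirectedSystem`), so that
`DirectLimit.of.zero_exact` is available for `H¹(K, A)`. [cite: Howard2004HeegnerKolyvagin, §1.6 (arXiv p. 12, L40–48)] -/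
theorem directedSystem_incH1LE :
    DirectedSystem (fun k => galoisCohomology (T.ρ k) 1) (fun i j h => incH1LE T π e hkill hker hπ he i j h) where
  map_self := fun i x => by
    have h0 : incH1LE T π e hkill hker hπ he i i le_rfl = AddMonoidHom.id _ := Nat.leRec_self _ _
    rw [h0]
    rfl
  map_map := fun k j i hij hjk x => incH1LE_incH1LE T π e hkill hker hπ he i j hij k hjk x

/-! ## §2 Index bookkeeping for the local iterates -/

/-- Transport of `incLoc` along an equality of levels (heterogeneous form).
[cite: Howard2004HeegnerKolyvagin, §1.6 (arXiv p. 11, L18–20)] -/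
theorem heq_incLoc (v : Place K) {n n' : ℕ} (h : n = n') {a : galoisCohomology ((T.ρ n).toLocal v) 1}
    {b : galoisCohomology ((T.ρ n').toLocal v) 1} (hab : HEq a b) :
    HEq (incLoc T π e hkill hker hπ he n v a) (incLoc T π e hkill hker hπ he n' v b) := by
  subst h
  rw [eq_of_heq hab]

/-- Membership in the local conditions is invariant under transport along an equality of levels.
[cite: Howard2004HeegnerKolyvagin, Def. 1.1.1 (arXiv p. 5, L20–24)] -/
theorem mem_iff_of_heq (F : ∀ k, SelmerStructure (T.ρ k)) (v : Place K) {n n' : ℕ} (h : n = n')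
    {a : galoisCohomology ((T.ρ n).toLocal v) 1} {b : galoisCohomology ((T.ρ n').toLocal v) 1} (hab : HEq a b) :
    a ∈ F n v ↔ b ∈ F n' v := by
  subst h
  rw [eq_of_heq hab]

/-- **`incLocIter (j+1) d ∘ incLoc j ≍ incLocIter j (d+1)`** (the levels `j+1+d` and `j+(d+1)` agree only propositionally).
[cite: Howard2004HeegnerKolyvagin, §1.6 (arXiv p. 11, L18–20)] -/
theorem incLocIter_succ_heq (j : ℕ) (v : Place K) :
    ∀ (d : ℕ) (x : galoisCohomology ((T.ρ j).toLocal v) 1),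
      HEq (incLocIter T π e hkill hker hπ he (j + 1) v d (incLoc T π e hkill hker hπ he j v x))
        (incLocIter T π e hkill hker hπ he j v (d + 1) x)
  | 0, _ => HEq.rfl
  | d + 1, x => heq_incLoc T π e hkill hker hπ he v (by omega) (incLocIter_succ_heq j v d x)

/-! ## §3 `condA F j v` is a directed union, carried into `condA F (j+1) v` by `H¹(K_v, inc_j)` -/

/-- The defining family of `condA F j v` increases with `d` (when `inc` respects the local conditions).
[cite: Howard2004HeegnerKolyvagin, Def. 1.1.3 and §1.6 (arXiv p. 5 L36–45, p. 11 L18–20)] -/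
theorem monotone_comap_incLocIter (F : ∀ k, SelmerStructure (T.ρ k))
    (hred : ∀ (k : ℕ) (v : Place K), ((F (k + 1)) v).map
      (ContinuousRep.cohomologyMap ((T.ρ (k + 1)).toLocal v) ((T.ρ k).toLocal v)
        (T.red k).toAddMonoidHom continuous_of_discreteTopology
        (fun _ x => T.red_equivariant k _ x) 1) = F k v)
    (hsmul : ∀ (k : ℕ) (v : Place K) (r : R), (F k v).map
      (scalarMapH1 ((T.ρ k).toLocal v) ((T.hlin k).restrictField _) r) ≤ F k v)
    (j : ℕ) (v : Place K) :
    Monotone fun d => (F (j + d) v).comap (incLocIter T π e hkill hker hπ he j v d) := by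
  refine monotone_nat_of_le_succ fun d x hx => ?_
  rw [AddSubgroup.mem_comap] at hx ⊢
  exact map_incLoc_le_of_cond_red_of_cond_smul T π e hkill hker hπ he F hred hsmul (j + d) v ⟨_, hx, rfl⟩

/-- **`x ∈ condA F j v ↔ ∃ d, incLocIter j v d x ∈ F_{j+d, v}`** (a directed union).
[cite: Howard2004HeegnerKolyvagin, §1.6 (arXiv p. 11, L18–20) with Def. 1.1.1] -/
theorem mem_condA_iff (F : ∀ k, SelmerStructure (T.ρ k))
    (hred : ∀ (k : ℕ) (v : Place K), ((F (k + 1)) v).map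
      (ContinuousRep.cohomologyMap ((T.ρ (k + 1)).toLocal v) ((T.ρ k).toLocal v)
        (T.red k).toAddMonoidHom continuous_of_discreteTopology
        (fun _ x => T.red_equivariant k _ x) 1) = F k v)
    (hsmul : ∀ (k : ℕ) (v : Place K) (r : R), (F k v).map
      (scalarMapH1 ((T.ρ k).toLocal v) ((T.hlin k).restrictField _) r) ≤ F k v)
    (j : ℕ) (v : Place K) (x : galoisCohomology ((T.ρ j).toLocal v) 1) :
    x ∈ condA T π e hkill hker hπ he F j v ↔ ∃ d, incLocIter T π e hkill hker hπ he j v d x ∈ F (j + d) v := by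
  unfold condA
  rw [AddSubgroup.mem_iSup_of_directed
    ((monotone_comap_incLocIter T π e hkill hker hπ he F hred hsmul j v).directed_le)]
  rfl

/-- **`H¹(K_v, inc_j)` carries `condA F j v` into `condA F (j+1) v`.**
[cite: Howard2004HeegnerKolyvagin, Def. 1.1.3 and §1.6 (arXiv p. 5 L36–45, p. 11 L18–20)] -/
theorem incLoc_mem_condA (F : ∀ k, SelmerStructure (T.ρ k))
    (hred : ∀ (k : ℕ) (v : Place K), ((F (k + 1)) v).map
      (ContinuousRep.cohomologyMap ((T.ρ (k + 1)).toLocal v) ((T.ρ k).toLocal v)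
        (T.red k).toAddMonoidHom continuous_of_discreteTopology
        (fun _ x => T.red_equivariant k _ x) 1) = F k v)
    (hsmul : ∀ (k : ℕ) (v : Place K) (r : R), (F k v).map
      (scalarMapH1 ((T.ρ k).toLocal v) ((T.hlin k).restrictField _) r) ≤ F k v)
    (j : ℕ) (v : Place K) {x : galoisCohomology ((T.ρ j).toLocal v) 1}
    (hx : x ∈ condA T π e hkill hker hπ he F j v) :
    incLoc T π e hkill hker hπ he j v x ∈ condA T π e hkill hker hπ he F (j + 1) v := by
  rw [mem_condA_iff T π e hkill hker hπ he F hred hsmul] at hx ⊢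
  obtain ⟨d, hd⟩ := hx
  cases d with
  | zero =>
    exact ⟨0, map_incLoc_le_of_cond_red_of_cond_smul T π e hkill hker hπ he F hred hsmul j v ⟨x, hd, rfl⟩⟩
  | succ d =>
    exact ⟨d, (mem_iff_of_heq T F v (by omega)
      (incLocIter_succ_heq T π e hkill hker hπ he j v d x)).mpr hd⟩

/-! ## §4 Selmer classes go to Selmer classes; `selmerA` is a directed union -/

/-- **`H¹(inc_j)` carries `H¹_{condA F j}(K, T_j)` into `H¹_{condA F (j+1)}(K, T_{j+1})`.**
[cite: Howard2004HeegnerKolyvagin, §1.6 / Thm. 1.6.1 (arXiv p. 11 L18–28, p. 12 L40–48)] -/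
theorem incH1_mem_selmerGroup_condA (F : ∀ k, SelmerStructure (T.ρ k))
    (hred : ∀ (k : ℕ) (v : Place K), ((F (k + 1)) v).map
      (ContinuousRep.cohomologyMap ((T.ρ (k + 1)).toLocal v) ((T.ρ k).toLocal v)
        (T.red k).toAddMonoidHom continuous_of_discreteTopology
        (fun _ x => T.red_equivariant k _ x) 1) = F k v)
    (hsmul : ∀ (k : ℕ) (v : Place K) (r : R), (F k v).map
      (scalarMapH1 ((T.ρ k).toLocal v) ((T.hlin k).restrictField _) r) ≤ F k v)
    (j : ℕ) {c : galoisCohomology (T.ρ j) 1} (hc : c ∈ (condA T π e hkill hker hπ he F j).selmerGroup) :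
    incH1 T π e hkill hker hπ he j c ∈ (condA T π e hkill hker hπ he F (j + 1)).selmerGroup := by
  rw [SelmerStructure.mem_selmerGroup_iff] at hc ⊢
  intro v
  rw [localization_incH1]
  exact incLoc_mem_condA T π e hkill hker hπ he F hred hsmul j v (hc v)

/-- `incH1LE i l` carries `H¹_{condA F i}` into `H¹_{condA F l}`. [cite: Howard2004HeegnerKolyvagin, §1.6 / Thm. 1.6.1 (arXiv p. 11 L18–28, p. 12 L40–48)] -/
theorem incH1LE_mem_selmerGroup_condA (F : ∀ k, SelmerStructure (T.ρ k))
    (hred : ∀ (k : ℕ) (v : Place K), ((F (k + 1)) v).map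
      (ContinuousRep.cohomologyMap ((T.ρ (k + 1)).toLocal v) ((T.ρ k).toLocal v)
        (T.red k).toAddMonoidHom continuous_of_discreteTopology
        (fun _ x => T.red_equivariant k _ x) 1) = F k v)
    (hsmul : ∀ (k : ℕ) (v : Place K) (r : R), (F k v).map
      (scalarMapH1 ((T.ρ k).toLocal v) ((T.hlin k).restrictField _) r) ≤ F k v)
    (i : ℕ) : ∀ (l : ℕ) (h : i ≤ l) {c : galoisCohomology (T.ρ i) 1},
      c ∈ (condA T π e hkill hker hπ he F i).selmerGroup →
        incH1LE T π e hkill hker hπ he i l h c ∈ (condA T π e hkill hker hπ he F l).selmerGroup := by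
  intro l h
  induction h with
  | refl =>
    intro c hc
    have h0 : incH1LE T π e hkill hker hπ he i i le_rfl = AddMonoidHom.id _ := Nat.leRec_self _ _
    rw [h0]
    exact hc
  | @step l hle ih =>
    intro c hc
    have h1 : incH1LE T π e hkill hker hπ he i (l + 1) (Nat.le.step hle) =
        (incH1 T π e hkill hker hπ he l).comp (incH1LE T π e hkill hker hπ he i l hle) :=
      Nat.leRec_succ _ _ hle
    rw [h1, AddMonoidHom.comp_apply]
    exact incH1_mem_selmerGroup_condA T π e hkill hker hπ he F hred hsmul l (ih hc)

/-- The defining family `j ↦ of_j(H¹_{condA F j})` of `selmerA` is monotone (hence directed).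
[cite: Howard2004HeegnerKolyvagin, Thm. 1.6.1 (arXiv p. 11 L18–28)] -/
theorem monotone_map_of_selmerGroup_condA (F : ∀ k, SelmerStructure (T.ρ k))
    (hred : ∀ (k : ℕ) (v : Place K), ((F (k + 1)) v).map
      (ContinuousRep.cohomologyMap ((T.ρ (k + 1)).toLocal v) ((T.ρ k).toLocal v)
        (T.red k).toAddMonoidHom continuous_of_discreteTopology
        (fun _ x => T.red_equivariant k _ x) 1) = F k v)
    (hsmul : ∀ (k : ℕ) (v : Place K) (r : R), (F k v).map
      (scalarMapH1 ((T.ρ k).toLocal v) ((T.hlin k).restrictField _) r) ≤ F k v) :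
    Monotone fun j => ((condA T π e hkill hker hπ he F j).selmerGroup).map
      (AddCommGroup.DirectLimit.of (fun k => galoisCohomology (T.ρ k) 1) (incH1LE T π e hkill hker hπ he) j) := by
  refine monotone_nat_of_le_succ fun j => ?_
  rintro _ ⟨c, hc, rfl⟩
  refine ⟨incH1 T π e hkill hker hπ he j c, incH1_mem_selmerGroup_condA T π e hkill hker hπ he F hred hsmul j hc, ?_⟩
  rw [← incH1LE_succ_self T π e hkill hker hπ he j (Nat.le_succ j) c]
  exact AddCommGroup.DirectLimit.of_f (G := fun k => galoisCohomology (T.ρ k) 1)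
    (f := incH1LE T π e hkill hker hπ he) (Nat.le_succ j) c

/-! ## §5 The single-representative criteria for `H¹_F(K, A)` -/

/-- **`a ∈ H¹_F(K, A) ↔ a = [c]` for some Selmer class `c` at some level** (the defining supremum is a directed union).
[cite: Howard2004HeegnerKolyvagin, Thm. 1.6.1 (arXiv p. 11 L18–28, p. 12 L40–48)] -/
theorem mem_selmerA_iff (F : ∀ k, SelmerStructure (T.ρ k))
    (hred : ∀ (k : ℕ) (v : Place K), ((F (k + 1)) v).map
      (ContinuousRep.cohomologyMap ((T.ρ (k + 1)).toLocal v) ((T.ρ k).toLocal v)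
        (T.red k).toAddMonoidHom continuous_of_discreteTopology
        (fun _ x => T.red_equivariant k _ x) 1) = F k v)
    (hsmul : ∀ (k : ℕ) (v : Place K) (r : R), (F k v).map
      (scalarMapH1 ((T.ρ k).toLocal v) ((T.hlin k).restrictField _) r) ≤ F k v)
    (a : H1A T π e hkill hker hπ he) :
    a ∈ selmerA T π e hkill hker hπ he F ↔
      ∃ (j : ℕ) (c : galoisCohomology (T.ρ j) 1), c ∈ (condA T π e hkill hker hπ he F j).selmerGroup ∧
        AddCommGroup.DirectLimit.of (fun k => galoisCohomology (T.ρ k) 1) (incH1LE T π e hkill hker hπ he) j c = a := by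
  unfold selmerA
  rw [AddSubgroup.mem_iSup_of_directed
    ((monotone_map_of_selmerGroup_condA T π e hkill hker hπ he F hred hsmul).directed_le)]
  constructor
  · rintro ⟨j, c, hc, rfl⟩
    exact ⟨j, c, hc, rfl⟩
  · rintro ⟨j, c, hc, rfl⟩
    exact ⟨j, c, hc, rfl⟩

/-- **`[c] ∈ H¹_F(K, A) ↔ ∃ l ≥ j, inc_{j→l} c ∈ H¹_{condA F l}(K, T_l)`** for a class `c` at level `j`: membership is
witnessed by ONE lift (`DirectLimit.of.zero_exact` on the directed system + Selmer classes go to Selmer classes).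
[cite: Howard2004HeegnerKolyvagin, Thm. 1.6.1 (arXiv p. 11 L18–28, p. 12 L40–48)] -/
theorem of_mem_selmerA_iff (F : ∀ k, SelmerStructure (T.ρ k))
    (hred : ∀ (k : ℕ) (v : Place K), ((F (k + 1)) v).map
      (ContinuousRep.cohomologyMap ((T.ρ (k + 1)).toLocal v) ((T.ρ k).toLocal v)
        (T.red k).toAddMonoidHom continuous_of_discreteTopology
        (fun _ x => T.red_equivariant k _ x) 1) = F k v)
    (hsmul : ∀ (k : ℕ) (v : Place K) (r : R), (F k v).map
      (scalarMapH1 ((T.ρ k).toLocal v) ((T.hlin k).restrictField _) r) ≤ F k v)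
    (j : ℕ) (c : galoisCohomology (T.ρ j) 1) :
    AddCommGroup.DirectLimit.of (fun k => galoisCohomology (T.ρ k) 1) (incH1LE T π e hkill hker hπ he) j c ∈ selmerA T π e hkill hker hπ he F ↔
      ∃ (l : ℕ) (h : j ≤ l), incH1LE T π e hkill hker hπ he j l h c ∈ (condA T π e hkill hker hπ he F l).selmerGroup := by
  haveI := directedSystem_incH1LE T π e hkill hker hπ he
  constructor
  · intro hc
    obtain ⟨i, c', hc', heq⟩ := (mem_selmerA_iff T π e hkill hker hπ he F hred hsmul _).mp hc
    -- move both representatives to the common level `max i j`, then to a level where they agree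
    have h0 : AddCommGroup.DirectLimit.of (fun k => galoisCohomology (T.ρ k) 1) (incH1LE T π e hkill hker hπ he) (max i j)
        (incH1LE T π e hkill hker hπ he i (max i j) (le_max_left i j) c' -
          incH1LE T π e hkill hker hπ he j (max i j) (le_max_right i j) c) = 0 := by
      rw [map_sub, AddCommGroup.DirectLimit.of_f, AddCommGroup.DirectLimit.of_f, heq, sub_self]
    obtain ⟨l, hl, hzero⟩ := AddCommGroup.DirectLimit.of.zero_exact _ _ h0
    refine ⟨l, (le_max_right i j).trans hl, ?_⟩
    rw [map_sub, sub_eq_zero, incH1LE_incH1LE, incH1LE_incH1LE] at hzero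
    rw [← hzero]
    exact incH1LE_mem_selmerGroup_condA T π e hkill hker hπ he F hred hsmul i l _ hc'
  · rintro ⟨l, h, hl⟩
    rw [← AddCommGroup.DirectLimit.of_f (G := fun k => galoisCohomology (T.ρ k) 1)
      (f := incH1LE T π e hkill hker hπ he) h c]
    exact (mem_selmerA_iff T π e hkill hker hπ he F hred hsmul _).mpr ⟨l, _, hl, rfl⟩

end AdicTower

/-! ## §6 For a `DVRSetting` with H.0–H.5 -/

namespace DVRSetting

variable {p : ℕ} [Fact p.Prime] {K : Type} [Field K] [NumberField K]
  {R : Type} [CommRing R] [IsDomain R] [IsDiscreteValuationRing R] [Algebra ℤ_[p] R]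
  {N : ℕ → Type} [∀ k, AddCommGroup (N k)] [∀ k, TopologicalSpace (N k)] [∀ k, DiscreteTopology (N k)]
  [∀ k, Module R (N k)]
  {Rk : ℕ → Type} [∀ k, CommRing (Rk k)] [∀ k, IsLocalRing (Rk k)] [∀ k, TopologicalSpace (Rk k)]
  [∀ k, DiscreteTopology (Rk k)] [∀ k, Algebra ℤ_[p] (Rk k)] [∀ k, Algebra R (Rk k)]
  [∀ k, Module (Rk k) (N k)] [∀ k, IsScalarTower R (Rk k) (N k)]
  {Nbar : Type} [AddCommGroup Nbar] [TopologicalSpace Nbar] [DiscreteTopology Nbar] [∀ k, Module (Rk k) Nbar]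
  {Nq : ℕ → Finset (HeightOneSpectrum (𝓞 K)) → Type} [∀ k n, AddCommGroup (Nq k n)]
  [∀ k n, TopologicalSpace (Nq k n)] [∀ k n, DiscreteTopology (Nq k n)] [∀ k n, Module (Rk k) (Nq k n)]
  [∀ k n, Module R (Nq k n)] [∀ k n, IsScalarTower R (Rk k) (Nq k n)]
  (S : DVRSetting p K R N Rk Nbar Nq) (hy : S.SatisfiesH)

/-- **`[c] ∈ H¹_F(K, A) ↔ ∃ l ≥ j, inc_{j→l} c ∈ H¹_{F, l}`** for a `DVRSetting` with H.0–H.5 (`F = (S.t ·).cond`, the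
hypotheses `cond_red`/`cond_smul` of the generic criterion being fields of `SatisfiesH`; any proofs `hπ`, `he`).
[cite: Howard2004HeegnerKolyvagin, Def. 1.1.1, Def. 1.1.3 and Thm. 1.6.1 (arXiv p. 5 L20–45, p. 11 L18–28)] -/
theorem of_mem_selmerA_iff (hπ : S.π ∈ IsLocalRing.maximalIdeal R) (he : ∀ k, S.e k ≤ S.e (k + 1))
    (j : ℕ) (c : galoisCohomology (S.T.ρ j) 1) :
    AddCommGroup.DirectLimit.of (fun k => galoisCohomology (S.T.ρ k) 1)
        (AdicTower.incH1LE S.T S.π S.e hy.killed hy.ker_red hπ he) j c ∈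
      S.T.selmerA S.π S.e hy.killed hy.ker_red hπ he (fun k => (S.t k).cond) ↔
      ∃ (l : ℕ) (h : j ≤ l), AdicTower.incH1LE S.T S.π S.e hy.killed hy.ker_red hπ he j l h c ∈
        (AdicTower.condA S.T S.π S.e hy.killed hy.ker_red hπ he (fun k => (S.t k).cond) l).selmerGroup :=
  AdicTower.of_mem_selmerA_iff S.T S.π S.e hy.killed hy.ker_red hπ he (fun k => (S.t k).cond) hy.cond_red hy.cond_smul j c

/-- **`a ∈ H¹_F(K, A) ↔ a = [c]` for a Selmer class `c` at some level**, for a `DVRSetting` with H.0–H.5.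
[cite: Howard2004HeegnerKolyvagin, Def. 1.1.1, Def. 1.1.3 and Thm. 1.6.1 (arXiv p. 5 L20–45, p. 11 L18–28)] -/
theorem mem_selmerA_iff (hπ : S.π ∈ IsLocalRing.maximalIdeal R) (he : ∀ k, S.e k ≤ S.e (k + 1))
    (a : AdicTower.H1A S.T S.π S.e hy.killed hy.ker_red hπ he) :
    a ∈ S.T.selmerA S.π S.e hy.killed hy.ker_red hπ he (fun k => (S.t k).cond) ↔
      ∃ (j : ℕ) (c : galoisCohomology (S.T.ρ j) 1),
        c ∈ (AdicTower.condA S.T S.π S.e hy.killed hy.ker_red hπ he (fun k => (S.t k).cond) j).selmerGroup ∧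
        AddCommGroup.DirectLimit.of (fun k => galoisCohomology (S.T.ρ k) 1)
          (AdicTower.incH1LE S.T S.π S.e hy.killed hy.ker_red hπ he) j c = a :=
  AdicTower.mem_selmerA_iff S.T S.π S.e hy.killed hy.ker_red hπ he (fun k => (S.t k).cond) hy.cond_red hy.cond_smul a

/-- `H¹(inc_j)` carries level-`j` Selmer classes to level-`(j+1)` Selmer classes, for a `DVRSetting` with H.0–H.5.
[cite: Howard2004HeegnerKolyvagin, Def. 1.1.3 and Thm. 1.6.1 (arXiv p. 5 L36–45, p. 11 L18–28)] -/
theorem incH1_mem_selmerGroup_condA (hπ : S.π ∈ IsLocalRing.maximalIdeal R) (he : ∀ k, S.e k ≤ S.e (k + 1))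
    (j : ℕ) {c : galoisCohomology (S.T.ρ j) 1}
    (hc : c ∈ (AdicTower.condA S.T S.π S.e hy.killed hy.ker_red hπ he (fun k => (S.t k).cond) j).selmerGroup) :
    AdicTower.incH1 S.T S.π S.e hy.killed hy.ker_red hπ he j c ∈
      (AdicTower.condA S.T S.π S.e hy.killed hy.ker_red hπ he (fun k => (S.t k).cond) (j + 1)).selmerGroup :=
  AdicTower.incH1_mem_selmerGroup_condA S.T S.π S.e hy.killed hy.ker_red hπ he (fun k => (S.t k).cond)
    hy.cond_red hy.cond_smul j hc

end DVRSetting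

end Literature.NumberTheory.GaloisCohomology.Howard2004

end
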